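import Literature.NumberTheory.Automorphic.MokStandardBaseChangeDescentContinuation
import Literature.NumberTheory.Automorphic.AsaiSignProofs
import HarnessLib

/-!
# `Mok2014_standardBaseChange_descent` follows from its corrected (continuation) statement and the
# corrected Asai dichotomy — no holomorphy hypothesis on the raw products

Topic `NumberTheory/Automorphic`; namespace `Literature.NumberTheory.Automorphic`. Proof file
(theorems only; provefact unit `Mok2014_archimedean_parity_of_asaiSign`, 2026-08-16), companion of
the accepted `MokStandardBaseChangeDescentContinuation.lean` and `AsaiSignProofs.lean`.

## What is proved and why it matters

`Mok2014_standardBaseChange_descent_iff_continuation` (accepted) proves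
`Mok2014_standardBaseChange_descent ↔ D'` — `D'` being its corrected statement, with the PRINTED
hypothesis "the continued partial `L^S(s, Π, As^{(-1)^{N-1}})` has a (simple) pole at `s = 1`" —
under two hypotheses: the corrected Asai dichotomy `hdich` (Mok, §2.5 and Thm. 2.5.4 (a), arXiv
p. 20; Grbac–Shahidi 2015, Thm. 4.3 (2)) and the holomorphy `hhol` of the RAW partial Asai Euler
products on `{1 < Re s}`, "the unpublished ingredient" (convergence of the raw product on
`1 < Re s ≤ C` is Ramanujan-strength for `N ≥ 3`). Its module docstring, and the "Discrepancy"
section of `MokWeakBaseChange.lean`, conclude that the named fact is "incomparable with the printed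
theorem … nor is it weaker than print".

The raw-to-continued bridge of `AsaiSignProofs.lean`
(`AutomorphicRepData.HasAsaiPole.false_of_continuation`: a raw pole of `L^S(s, Π, As^η)` at `1⁺` is
incompatible with a holomorphic continuation of `L^S(s, Π, As^η)` to `{1/2 < Re s}`, proved by Baire's
theorem, Cauchy estimates and the Weierstrass `M`-test, with no convergence hypothesis) removes
`hhol` from the direction `D' → Mok2014_standardBaseChange_descent`:
`Mok2014_standardBaseChange_descent_of_continuation` below. Consequently, GIVEN the corrected
dichotomy, the named fact `Mok2014_standardBaseChange_descent` (raw `HasAsaiSign` in hypothesis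
position) IS weaker than — implied by — its corrected, print-faithful statement `D'`: every
conjugate self-dual cuspidal `Π` with a raw Asai pole at `As^{(-1)^{N-1}}` has a continued pole
there (the dichotomy sign cannot be the other one), so `D'` applies. The direction `→` of the
accepted equivalence still uses `hhol` (a continued pole need not be a raw pole without convergence
of the raw product on `{1 < Re s}`; unconditional for tempered data,
`Mok2014_standardBaseChange_descent.exists_isWeakBaseChange_of_continuation`), and nothing here
touches the raw-CONCLUSION fact `Mok2014_partialAsaiL_pole_dichotomy` (deprecated), whose verdict
stands. Statements are copied byte-for-byte from `Mok2014_standardBaseChange_descent_iff_continuation`.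

## References

* C. P. Mok, *Endoscopic classification of representations of quasi-split unitary groups*,
  Mem. Amer. Math. Soc. 235 (2015), no. 1108 (arXiv:1206.0882): Thm. 2.4.2 (p. 13), §2.5 and
  Thm. 2.5.4 (a) (p. 20), Remark 2.5.5 (p. 21). [Mok2014]
* N. Grbac, F. Shahidi, *Endoscopic transfer for unitary groups and holomorphy of Asai
  `L`-functions*, Pacific J. Math. 276 (2015), 185–211: §2.A, Thm. 4.3 (2). [GrbacShahidi2015]
-/

noncomputable section

open scoped Topology Classical
open NumberField IsDedekindDomain Filter

namespace Literature.NumberTheory.Automorphic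

/-- **`Mok2014_standardBaseChange_descent` from its corrected statement and the corrected Asai
dichotomy, unconditionally in the raw products.** Hypotheses: `hdich`, verbatim the corrected
dichotomy of `Mok2014_standardBaseChange_descent_iff_continuation` /
`Mok2014_partialAsaiL_pole_dichotomy_of_continuation` (Mok, §2.5: "exactly one of the functions
`L(s, φ^N, As^±)` has a pole at `s = 1`, which is a simple pole", Thm. 2.5.4 (a); Grbac–Shahidi 2015,
Thm. 4.3 (2)); and `h`, verbatim the corrected statement `D'` (right-hand side of that
equivalence: Mok, Thm. 2.4.2 with Thm. 2.5.4 (a) / Remark 2.5.5, direction "if", for the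
CONTINUED partial Asai `L`-function). Conclusion: the named fact `Mok2014_standardBaseChange_descent`
(`MokWeakBaseChange.lean`, raw `HasAsaiSign Π c 1` in hypothesis position). Proof: for a datum
`(S, A)`, the dichotomy sign `η(Π)` is `(-1)^{N-1}` — otherwise the holomorphic continuation `H` of
`L^S(s, Π, As^{(-1)^{N-1}})` would contradict the raw pole
(`AutomorphicRepData.HasAsaiPole.false_of_continuation`, no holomorphy hypothesis) —, so `hdich`
yields the multipliability and the continued simple pole that `D'` requires. This is the direction
`←` of `Mok2014_standardBaseChange_descent_iff_continuation` with its hypothesis `hhol` removed.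
[cite: Mok2014, Thm. 2.4.2 (arXiv p. 13), §2.5, Thm. 2.5.4 (a) and Remark 2.5.5 (arXiv pp. 20–21)]
[cite: GrbacShahidi2015, Thm. 4.3 (2)] -/
theorem Mok2014_standardBaseChange_descent_of_continuation
    (hdich : ∀ (F E : Type) [Field F] [NumberField F] [Field E] [NumberField E] [Algebra F E]
        (c : E ≃ₐ[F] E), Module.finrank F E = 2 → c ≠ 1 →
        ∀ (N : ℕ) (hcpt : isCompact_glFiniteIntegralLevel N E)
          (π : CuspidalAutomorphicRepData N E hcpt), 0 < N → π.1.IsConjSelfDualAE c →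
          ∃ η : ℤˣ, ∀ (S : Set (HeightOneSpectrum (𝓞 F))) (A : SatakeFamily E),
            π.1.IsAsaiDatum c S A →
              ∃ σ₀ : ℝ, 1 ≤ σ₀ ∧
                (∀ (θ : ℤˣ) (s : ℂ), σ₀ < s.re →
                  Multipliable fun v : {v : HeightOneSpectrum (𝓞 F) // v ∉ S} =>
                    ((asaiLocalPolynomial c A θ (placeAbove E v.1)).eval
                      ((v.1.residueCard : ℂ) ^ (-s)))⁻¹) ∧
                (∃ G : ℂ → ℂ, DifferentiableOn ℂ G {s : ℂ | 1 / 2 < s.re} ∧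
                  (∀ s : ℂ, σ₀ < s.re → G s = (s - 1) * partialAsaiL S c A η s) ∧ G 1 ≠ 0) ∧
                (∃ H : ℂ → ℂ, DifferentiableOn ℂ H {s : ℂ | 1 / 2 < s.re} ∧
                  (∀ s : ℂ, σ₀ < s.re → H s = partialAsaiL S c A (-η) s) ∧ H 1 ≠ 0))
    (h : ∀ (F E : Type) [Field F] [NumberField F] [Field E] [NumberField E] [Algebra F E]
        (c : E ≃ₐ[F] E), Module.finrank F E = 2 → c ≠ 1 →
        ∀ (N : ℕ) (hcpt : isCompact_glFiniteIntegralLevel N E)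
          (P : CuspidalAutomorphicRepData N E hcpt), 0 < N → P.1.IsConjSelfDualAE c →
          (∀ (S : Set (HeightOneSpectrum (𝓞 F))) (A : SatakeFamily E), P.1.IsAsaiDatum c S A →
              ∃ σ₀ : ℝ, 1 ≤ σ₀ ∧
                (∀ s : ℂ, σ₀ < s.re →
                  Multipliable fun v : {v : HeightOneSpectrum (𝓞 F) // v ∉ S} =>
                    ((asaiLocalPolynomial c A ((-1) ^ (N + 1)) (placeAbove E v.1)).eval
                      ((v.1.residueCard : ℂ) ^ (-s)))⁻¹) ∧
                ∃ G : ℂ → ℂ, DifferentiableOn ℂ G {s : ℂ | 1 / 2 < s.re} ∧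
                  (∀ s : ℂ, σ₀ < s.re →
                    G s = (s - 1) * partialAsaiL S c A ((-1) ^ (N + 1)) s) ∧ G 1 ≠ 0) →
          ∃ π : UnitaryGroupAutomorphicRep F E c N hcpt,
            UnitaryGroup.IsWeakBaseChange F E c N hcpt P.1 π) :
    Mok2014_standardBaseChange_descent := by
  intro F E _ _ _ _ _ c h2 hc N hcpt P hN hcsd hsign
  refine h F E c h2 hc N hcpt P hN hcsd fun S A hSA => ?_
  obtain ⟨η, hη⟩ := hdich F E c h2 hc N hcpt P hN hcsd
  obtain ⟨σ₀, hσ₀, hmult, ⟨G, hG, hGL, hG1⟩, ⟨H, hH, hHL, -⟩⟩ := hη S A hSA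
  -- the raw pole at `(-1)^{N-1}` given by the hypothesis of the named fact
  have hpole : P.1.HasAsaiPole c ((-1) ^ (N + 1)) := by
    simpa only [AutomorphicRepData.hasAsaiSign_iff, mul_one] using hsign
  set θ : ℤˣ := (-1) ^ (N + 1) with hθ
  clear_value θ
  by_cases hηθ : η = θ
  · subst hηθ
    exact ⟨σ₀, hσ₀, fun s hs => hmult _ s hs, G, hG, hGL, hG1⟩
  · have hneg : -η = θ := by rw [Int.units_ne_iff_eq_neg.mp hηθ, neg_neg]
    exact (hpole.false_of_continuation hSA hH (fun s hs => by rw [hHL s hs, hneg])).elim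

end Literature.NumberTheory.Automorphic
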